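/-
Copyright (c) 2026 the pub-hodgecm-mathlib formalisation cell (harness21).  Prover seat hodgecm-mathlib-K2E5-p17 (g10), Track B ∕ K2-LIT, h413 = `stmt-HodgeConjecture-24833`,
R90-TF section S8 «ContSpec-n½ ∕ ResidualSpectrum», socket (E) `B :276`, S8 dealer R90-CS-plan (g4) RULING J-S8-ASSOC (S8-R297 (c)) «GO: the Hilbert half of ASSOC,
hypothesis-first on the named analytic letter».
-/
import Summits.HodgeConjecture.HodgeConjecture.Theorems.R90S8ResGBlockCoverOfTransversalU3     -- ★ p865179 (this seat): `hHead_level_of_niceCoreAll_of_transversal` (`hassoc` binder); brings ★ p865138 §0 `topologicalClosure_span_le_topologicalClosure_of_subset`, ★ `resGBlock`, ★ `reflectChar`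
import HarnessLib

/-!
# S8 (E) `B :276` — `R90S8ResGBlockAssocOfGramU3`: THE HILBERT-SPACE HALF OF ASSOC [MW II.2.1] — «associate Borel data have the same block», `Sc(K′,ω; χ₁ʷ, χ₂) ≤ Sc(K′,ω; χ₁, χ₂)`,
# FROM AN AXIS MODEL: a linear map `U` into any normed space that is ISOMETRIC on the joint span of the two generating families (the three Gram identities = GRAM₃) and sends the
# `χʷ`-generators into the closure of the image of the `χ`-span (the functional equation read in the model)

Track B ∕ K2-LIT, crux h413 = `stmt-HodgeConjecture-24833`, route of record `HCCMUnconditional`; cell `hodgecm-mathlib`, R90-TF programme, section S8.  THEOREMS ONLY (no `def`, no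
`instance`, no notation, no named-fact hypothesis, no `sorry`; default heartbeats); lane `--kind proof --supports stmt-HodgeConjecture-24833 --as helper` (count-neutral); imports ★ only.
CLOSES NO SOCKET.

WHERE THIS SITS (RULING J-S8-ASSOC, S8-R297).  (HEAD₃) = ★ p865138 ∘ ★ p865179 modulo {GEN₃^X (L), ASSOC (L)}, ASSOC = `∀ Kf b, resGBlock L μ (ι_f Kf) 1 (reflectChar c (χ₁ b)) (χ₂ b) ≤
resGBlock L μ (ι_f Kf) 1 (χ₁ b) (χ₂ b)` (★ p865179's `hassoc`).  For SELF-associate data it is `le_rfl`; for non-self-associate data it is the `L²` FUNCTIONAL EQUATION of the block, booked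
INSIDE THE E1 PLANCHEREL ESTATE: {the block isometry of PB-3∕PB-4 for `χ` AND `χʷ` into ONE axis model, `M(w, ·)` unitary on the axis (PB-2's `hFE`∕`hcs`), no poles in between (★ F5
shape)}.  THIS FILE is the HILBERT-SPACE HALF, letter-free: it reduces ASSOC to exactly those model statements.
* §1 (generic normed spaces) **`subset_closure_span_of_model`** ∕ **`topologicalClosure_span_le_of_model`**: `H`, `𝓜` normed `ℂ`-spaces, `S T ⊆ H`, `U : H →ₗ[ℂ] 𝓜` with (ISO) `‖U a‖ = ‖a‖`
  on `span (S ∪ T)` (⟸ the three families of Gram identities `⟪s,s′⟫, ⟪t,t′⟫, ⟪s,t⟫` computed by ONE axis pairing — GRAM₃) and (FE) `U t ∈ closure (U(span S))` for `t ∈ T` ⟹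
  `T ⊆ closure (span S)`, hence `cl span T ≤ cl span S`.  Proof: `dist(t, s) = ‖U t − U s‖` for `s ∈ span S`.
* §2 (the blocks) **`resGBlock_reflectChar_le_of_axisModel`**: at any `(K′, ω, χ₁, χ₂)`, an axis model `(𝓜, U)` with (ISO) on the joint span of the two generating wave-packet families
  (`resGBlock_def`'s set-builder bytes at `(χ₁, χ₂)` and at `(χ₁ʷ, χ₂)`) and (FE) ⟹ `resGBlock L μ K′ ω (reflectChar c χ₁) χ₂ ≤ resGBlock L μ K′ ω χ₁ χ₂` (`resGBlock_def` is `rfl`).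
* §3 (the consumer's binder) **`hassoc_of_axisModels`**: per `(Kf, b)` axis models ⟹ ★ p865179's `hassoc` BYTES; **`hHead_level_of_niceCoreAll_of_axisModels`** = (HEAD₃) `hHead_level`
  ⟸ {GEN₃^X `hall`, WITNESS_β `hmem`, per-block axis models (ISO)+(FE)} + Borel guards (★ `hHead_level_of_niceCoreAll_of_transversal` ∘ §3).
NET: ASSOC = ★ (this file) modulo the named model letters (ISO) = GRAM₃ and (FE) — both inside the E1 Plancherel estate (PB-2∕3∕4), no new mathematics owed outside it.
HONEST LABEL: pays no socket and no printed citation; (ISO)∕(FE) stay OPEN and NAMED; HC_CM is proved only modulo the 7 printed citations (2 remaining named inputs: hLiu418 =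
`stmt-HodgeConjecture-24832`, h413 = `stmt-HodgeConjecture-24833`) until rung 0 closes; REL ≠ ★ ≠ BUILT; count-neutral.

## References
* [MoeglinWaldspurger1995] C. Mœglin, J.-L. Waldspurger, *Spectral Decomposition and Eisenstein Series* (1995), II.1.7, II.2.1 (inner products of pseudo-Eisenstein series), IV.1.10–11
  (functional equation, unitarity of `M(w, π)` on the unitary axis), V.3.13.
* [Langlands1976] R. P. Langlands, *On the Functional Equations Satisfied by Eisenstein Series*, LNM 544 (1976), §7.
* [DeitmarEchterhoff2014] A. Deitmar, S. Echterhoff, *Principles of Harmonic Analysis* (2nd ed., 2014), Lemma 7.2.6.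
-/

set_option autoImplicit false
set_option linter.dupNamespace false  -- the mandated namespace `…HodgeConjecture.HodgeConjecture.R90.S8` (LEAD #1 L1) repeats the summit's segment

noncomputable section

open MeasureTheory Measure Set Filter Topology NumberField
open Literature.MeasureTheory.Group Literature.NumberTheory Literature.NumberTheory.Automorphic Literature.NumberTheory.Automorphic.UnitaryGroup
open Literature.NumberTheory.GaloisRepresentations AdelicGroupData ContRepresentation
open Literature.NumberTheory.Automorphic.Arthur2013.Leaves.TECR
open Summit.HodgeConjecture.HodgeConjecture.Cruxes.H413.K2E1BorelEisensteinU
open Summit.HodgeConjecture.HodgeConjecture.Cruxes.H413.K2E1ChiSectionSpaceU3PairDefs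
open Summit.HodgeConjecture.HodgeConjecture.Cruxes.H413.K2E1CharacterEisensteinU2Defs (reflectChar)
open scoped ENNReal NNReal Pointwise

namespace Summit.HodgeConjecture.HodgeConjecture.R90.S8

/-! ## §1 Generic normed spaces: a set lies in the closed span of another through an isometric model -/

section Generic

variable {H 𝓜 : Type*} [NormedAddCommGroup H] [NormedSpace ℂ H] [NormedAddCommGroup 𝓜] [NormedSpace ℂ 𝓜]

/-- **GRAM TRANSFER.**  `U : H →ₗ[ℂ] 𝓜` isometric on `span (S ∪ T)` (ISO) and with `U t ∈ closure (U (span S))` for every `t ∈ T` (FE) ⟹ `T ⊆ closure (span S)`: for `s ∈ span S`,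
`dist(t, s) = ‖U(t − s)‖ = dist(U t, U s)`. [cite: DeitmarEchterhoff2014, Lemma 7.2.6] [cite: MoeglinWaldspurger1995, II.2.1] -/
theorem subset_closure_span_of_model (S T : Set H) (U : H →ₗ[ℂ] 𝓜)
    (hU : ∀ a ∈ Submodule.span ℂ (S ∪ T), ‖U a‖ = ‖a‖)
    (hT : ∀ t ∈ T, U t ∈ closure (((Submodule.span ℂ S).map U : Submodule ℂ 𝓜) : Set 𝓜)) :
    T ⊆ closure ((Submodule.span ℂ S : Submodule ℂ H) : Set H) := by
  intro t ht
  refine Metric.mem_closure_iff.2 fun ε hε => ?_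
  obtain ⟨m, hm, hdist⟩ := Metric.mem_closure_iff.1 (hT t ht) ε hε
  obtain ⟨s, hs, rfl⟩ := (Submodule.mem_map.1 hm)
  refine ⟨s, hs, ?_⟩
  have hts : t - s ∈ Submodule.span ℂ (S ∪ T) :=
    Submodule.sub_mem _ (Submodule.subset_span (Or.inr ht)) (Submodule.span_mono Set.subset_union_left hs)
  rw [dist_eq_norm, ← hU _ hts, map_sub, ← dist_eq_norm]
  exact hdist

/-- **… hence `cl span T ≤ cl span S`** (★ p865138 §0 `topologicalClosure_span_le_topologicalClosure_of_subset`). [cite: DeitmarEchterhoff2014, Lemma 7.2.6] -/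
theorem topologicalClosure_span_le_of_model (S T : Set H) (U : H →ₗ[ℂ] 𝓜)
    (hU : ∀ a ∈ Submodule.span ℂ (S ∪ T), ‖U a‖ = ‖a‖)
    (hT : ∀ t ∈ T, U t ∈ closure (((Submodule.span ℂ S).map U : Submodule ℂ 𝓜) : Set 𝓜)) :
    (Submodule.span ℂ T).topologicalClosure ≤ (Submodule.span ℂ S).topologicalClosure :=
  topologicalClosure_span_le_topologicalClosure_of_subset T (Submodule.span ℂ S)
    (by rw [Submodule.topologicalClosure_coe]; exact subset_closure_span_of_model S T U hU hT)

end Generic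

/-! ## §2 The blocks: ASSOC from an axis model -/

section Blocks

variable (L : Type) [Field L] [NumberField L] [IsCMField L]
  (μ : Measure (quasiSplit (↥(maximalRealSubfield L)) L (IsCMField.complexConj L) 3).automorphicQuotient)

/-- **ASSOC FROM AN AXIS MODEL** [MW II.2.1]: at a level datum `(K′, ω)` and a Borel pair datum `(χ₁, χ₂)`, suppose a normed `ℂ`-space `𝓜` and a linear `U : L² →ₗ[ℂ] 𝓜` are (ISO) isometric on
the joint span of the generating wave packets of `Sc(χ₁, χ₂)` and of `Sc(χ₁ʷ, χ₂)` (= GRAM₃: the inner products `⟪θ,θ′⟫`, `⟪θʷ,θʷ′⟫`, `⟪θ,θʷ⟫` all computed by the axis pairing — PB-2's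
contour shift + MW II.2.1) and (FE) send every `χʷ`-wave packet into the closure of `U(span` of the `χ`-wave packets`)` (the functional equation `M(w,·)` read in the model, `M` unitary
on the axis).  Then `Sc(K′, ω; χ₁ʷ, χ₂) ≤ Sc(K′, ω; χ₁, χ₂)` (`resGBlock_def` is `rfl`; §1). [cite: MoeglinWaldspurger1995, II.2.1, IV.1.10] [cite: Langlands1976, §7] -/
theorem resGBlock_reflectChar_le_of_axisModel (K' : Subgroup (quasiSplit (↥(maximalRealSubfield L)) L (IsCMField.complexConj L) 3).Adelic) (ω : ↥K' →* ℂ)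
    (χ₁ : HeckeCharacter L) (χ₂ : (↥(TorusDict.torus (IsCMField.complexConj L)) →ₜ* ℂˣ))
    {𝓜 : Type*} [NormedAddCommGroup 𝓜] [NormedSpace ℂ 𝓜] (U : (quasiSplit (↥(maximalRealSubfield L)) L (IsCMField.complexConj L) 3).L2 μ →ₗ[ℂ] 𝓜)
    (hU : ∀ a ∈ Submodule.span ℂ
      ({v : (quasiSplit (↥(maximalRealSubfield L)) L (IsCMField.complexConj L) 3).L2 μ |
          ∃ (f : ℝ → ℂ) (_ : Continuous f) (_ : HasCompactSupport f) (_ : tsupport f ⊆ Ioi 0)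
            (φ : (quasiSplit (↥(maximalRealSubfield L)) L (IsCMField.complexConj L) 3).Adelic → ℂ) (_ : φ ∈ chiSectionSpacePair χ₁ χ₂ K' (ω : ↥K' → ℂ)) (_ : Continuous φ)
            (hv : MemLp ((quasiSplit (↥(maximalRealSubfield L)) L (IsCMField.complexConj L) 3).quotFun (eisensteinSeriesU (fun g => f (borelHeight g) * φ g))) 2 μ), v = hv.toLp _} ∪
       {v : (quasiSplit (↥(maximalRealSubfield L)) L (IsCMField.complexConj L) 3).L2 μ |
          ∃ (f : ℝ → ℂ) (_ : Continuous f) (_ : HasCompactSupport f) (_ : tsupport f ⊆ Ioi 0)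
            (φ : (quasiSplit (↥(maximalRealSubfield L)) L (IsCMField.complexConj L) 3).Adelic → ℂ) (_ : φ ∈ chiSectionSpacePair (reflectChar (IsCMField.complexConj L) χ₁) χ₂ K' (ω : ↥K' → ℂ)) (_ : Continuous φ)
            (hv : MemLp ((quasiSplit (↥(maximalRealSubfield L)) L (IsCMField.complexConj L) 3).quotFun (eisensteinSeriesU (fun g => f (borelHeight g) * φ g))) 2 μ), v = hv.toLp _}), ‖U a‖ = ‖a‖)
    (hFE : ∀ t ∈ {v : (quasiSplit (↥(maximalRealSubfield L)) L (IsCMField.complexConj L) 3).L2 μ |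
          ∃ (f : ℝ → ℂ) (_ : Continuous f) (_ : HasCompactSupport f) (_ : tsupport f ⊆ Ioi 0)
            (φ : (quasiSplit (↥(maximalRealSubfield L)) L (IsCMField.complexConj L) 3).Adelic → ℂ) (_ : φ ∈ chiSectionSpacePair (reflectChar (IsCMField.complexConj L) χ₁) χ₂ K' (ω : ↥K' → ℂ)) (_ : Continuous φ)
            (hv : MemLp ((quasiSplit (↥(maximalRealSubfield L)) L (IsCMField.complexConj L) 3).quotFun (eisensteinSeriesU (fun g => f (borelHeight g) * φ g))) 2 μ), v = hv.toLp _},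
      U t ∈ closure (((Submodule.span ℂ
        {v : (quasiSplit (↥(maximalRealSubfield L)) L (IsCMField.complexConj L) 3).L2 μ |
          ∃ (f : ℝ → ℂ) (_ : Continuous f) (_ : HasCompactSupport f) (_ : tsupport f ⊆ Ioi 0)
            (φ : (quasiSplit (↥(maximalRealSubfield L)) L (IsCMField.complexConj L) 3).Adelic → ℂ) (_ : φ ∈ chiSectionSpacePair χ₁ χ₂ K' (ω : ↥K' → ℂ)) (_ : Continuous φ)
            (hv : MemLp ((quasiSplit (↥(maximalRealSubfield L)) L (IsCMField.complexConj L) 3).quotFun (eisensteinSeriesU (fun g => f (borelHeight g) * φ g))) 2 μ), v = hv.toLp _}).map U : Submodule ℂ 𝓜) : Set 𝓜)) :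
    resGBlock L μ K' ω (reflectChar (IsCMField.complexConj L) χ₁) χ₂ ≤ resGBlock L μ K' ω χ₁ χ₂ :=
  topologicalClosure_span_le_of_model _ _ U hU hFE

end Blocks

/-! ## §3 The consumer's `hassoc` binder (★ p865179) from per-block axis models, and (HEAD₃) re-assembled -/

section Assembly

variable (L : Type) [Field L] [NumberField L] [IsCMField L]
  (μ : Measure (quasiSplit (↥(maximalRealSubfield L)) L (IsCMField.complexConj L) 3).automorphicQuotient)

/-- **★ p865179's `hassoc` FROM PER-BLOCK AXIS MODELS**: for the consumer's family `b ↦ (χ₁ b, χ₂ b)` and every finite level of record `Kf`, an axis model `(𝓜, U)` with (ISO)+(FE) at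
`(ι_f Kf, 1, χ₁ b, χ₂ b)` gives `resGBlock L μ (ι_f Kf) 1 (reflectChar c (χ₁ b)) (χ₂ b) ≤ resGBlock L μ (ι_f Kf) 1 (χ₁ b) (χ₂ b)` — the `hassoc` binder of ★
`hHead_level_of_niceCoreAll_of_transversal` ∕ ★ `hcov_of_transversal` BYTE FOR BYTE. [cite: MoeglinWaldspurger1995, II.2.1] -/
theorem hassoc_of_axisModels
    {β : Type*} (χ₁ : β → HeckeCharacter L) (χ₂ : β → (↥(TorusDict.torus (IsCMField.complexConj L)) →ₜ* ℂˣ))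
    {𝓜 : {Kf : Subgroup ↥(finAdelic (↥(maximalRealSubfield L)) L (IsCMField.complexConj L) 3 ((StdForm.antidiagonal 3).over L)) // IsOpen ((Kf : Subgroup ↥(finAdelic (↥(maximalRealSubfield L)) L (IsCMField.complexConj L) 3 ((StdForm.antidiagonal 3).over L))) : Set ↥(finAdelic (↥(maximalRealSubfield L)) L (IsCMField.complexConj L) 3 ((StdForm.antidiagonal 3).over L))) ∧ Kf ≤ ((((standardMaximalCompactGL 3 L).comap (adelicVal (↥(maximalRealSubfield L)) L (IsCMField.complexConj L) 3 ((StdForm.antidiagonal 3).over L)) : Subgroup (quasiSplit (↥(maximalRealSubfield L)) L (IsCMField.complexConj L) 3).Adelic)).comap (finAdelicToAdelic (↥(maximalRealSubfield L)) L (IsCMField.complexConj L) 3 ((StdForm.antidiagonal 3).over L)) : Subgroup ↥(finAdelic (↥(maximalRealSubfield L)) L (IsCMField.complexConj L) 3 ((StdForm.antidiagonal 3).over L)))} → β → Type*}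
    [∀ Kf b, NormedAddCommGroup (𝓜 Kf b)] [∀ Kf b, NormedSpace ℂ (𝓜 Kf b)]
    (U : ∀ (Kf : {Kf : Subgroup ↥(finAdelic (↥(maximalRealSubfield L)) L (IsCMField.complexConj L) 3 ((StdForm.antidiagonal 3).over L)) // IsOpen ((Kf : Subgroup ↥(finAdelic (↥(maximalRealSubfield L)) L (IsCMField.complexConj L) 3 ((StdForm.antidiagonal 3).over L))) : Set ↥(finAdelic (↥(maximalRealSubfield L)) L (IsCMField.complexConj L) 3 ((StdForm.antidiagonal 3).over L))) ∧ Kf ≤ ((((standardMaximalCompactGL 3 L).comap (adelicVal (↥(maximalRealSubfield L)) L (IsCMField.complexConj L) 3 ((StdForm.antidiagonal 3).over L)) : Subgroup (quasiSplit (↥(maximalRealSubfield L)) L (IsCMField.complexConj L) 3).Adelic)).comap (finAdelicToAdelic (↥(maximalRealSubfield L)) L (IsCMField.complexConj L) 3 ((StdForm.antidiagonal 3).over L)) : Subgroup ↥(finAdelic (↥(maximalRealSubfield L)) L (IsCMField.complexConj L) 3 ((StdForm.antidiagonal 3).over L)))}) (b : β), (quasiSplit (↥(maximalRealSubfield L))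 L (IsCMField.complexConj L) 3).L2 μ →ₗ[ℂ] 𝓜 Kf b)
    (hU : ∀ (Kf : {Kf : Subgroup ↥(finAdelic (↥(maximalRealSubfield L)) L (IsCMField.complexConj L) 3 ((StdForm.antidiagonal 3).over L)) // IsOpen ((Kf : Subgroup ↥(finAdelic (↥(maximalRealSubfield L)) L (IsCMField.complexConj L) 3 ((StdForm.antidiagonal 3).over L))) : Set ↥(finAdelic (↥(maximalRealSubfield L)) L (IsCMField.complexConj L) 3 ((StdForm.antidiagonal 3).over L))) ∧ Kf ≤ ((((standardMaximalCompactGL 3 L).comap (adelicVal (↥(maximalRealSubfield L)) L (IsCMField.complexConj L) 3 ((StdForm.antidiagonal 3).over L)) : Subgroup (quasiSplit (↥(maximalRealSubfield L)) L (IsCMField.complexConj L) 3).Adelic)).comap (finAdelicToAdelic (↥(maximalRealSubfield L)) L (IsCMField.complexConj L) 3 ((StdForm.antidiagonal 3).over L)) : Subgroup ↥(finAdelic (↥(maximalRealSubfield L)) L (IsCMField.complexConj L) 3 ((StdForm.antidiagonal 3).over L)))}) (b : β), ∀ a ∈ Submodule.span ℂ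
      ({v : (quasiSplit (↥(maximalRealSubfield L)) L (IsCMField.complexConj L) 3).L2 μ |
          ∃ (f : ℝ → ℂ) (_ : Continuous f) (_ : HasCompactSupport f) (_ : tsupport f ⊆ Ioi 0)
            (φ : (quasiSplit (↥(maximalRealSubfield L)) L (IsCMField.complexConj L) 3).Adelic → ℂ) (_ : φ ∈ chiSectionSpacePair (χ₁ b) (χ₂ b) (Kf.1.map (finAdelicToAdelic (↥(maximalRealSubfield L)) L (IsCMField.complexConj L) 3 ((StdForm.antidiagonal 3).over L))) ((1 : ↥(Kf.1.map (finAdelicToAdelic (↥(maximalRealSubfield L)) L (IsCMField.complexConj L) 3 ((StdForm.antidiagonal 3).over L))) →* ℂ) : ↥(Kf.1.map (finAdelicToAdelic (↥(maximalRealSubfield L)) L (IsCMField.complexConj L) 3 ((StdForm.antidiagonal 3).over L))) → ℂ)) (_ : Continuous φ)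
            (hv : MemLp ((quasiSplit (↥(maximalRealSubfield L)) L (IsCMField.complexConj L) 3).quotFun (eisensteinSeriesU (fun g => f (borelHeight g) * φ g))) 2 μ), v = hv.toLp _} ∪
       {v : (quasiSplit (↥(maximalRealSubfield L)) L (IsCMField.complexConj L) 3).L2 μ |
          ∃ (f : ℝ → ℂ) (_ : Continuous f) (_ : HasCompactSupport f) (_ : tsupport f ⊆ Ioi 0)
            (φ : (quasiSplit (↥(maximalRealSubfield L)) L (IsCMField.complexConj L) 3).Adelic → ℂ) (_ : φ ∈ chiSectionSpacePair (reflectChar (IsCMField.complexConj L) (χ₁ b)) (χ₂ b) (Kf.1.map (finAdelicToAdelic (↥(maximalRealSubfield L)) L (IsCMField.complexConj L) 3 ((StdForm.antidiagonal 3).over L))) ((1 : ↥(Kf.1.map (finAdelicToAdelic (↥(maximalRealSubfield L)) L (IsCMField.complexConj L) 3 ((StdForm.antidiagonal 3).over L))) →* ℂ) : ↥(Kf.1.map (finAdelicToAdelic (↥(maximalRealSubfield L)) L (IsCMField.complexConj L) 3 ((StdForm.antidiagonal 3).over L))) → ℂ)) (_ : Continuous φ)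
            (hv : MemLp ((quasiSplit (↥(maximalRealSubfield L)) L (IsCMField.complexConj L) 3).quotFun (eisensteinSeriesU (fun g => f (borelHeight g) * φ g))) 2 μ), v = hv.toLp _}), ‖U Kf b a‖ = ‖a‖)
    (hFE : ∀ (Kf : {Kf : Subgroup ↥(finAdelic (↥(maximalRealSubfield L)) L (IsCMField.complexConj L) 3 ((StdForm.antidiagonal 3).over L)) // IsOpen ((Kf : Subgroup ↥(finAdelic (↥(maximalRealSubfield L)) L (IsCMField.complexConj L) 3 ((StdForm.antidiagonal 3).over L))) : Set ↥(finAdelic (↥(maximalRealSubfield L)) L (IsCMField.complexConj L) 3 ((StdForm.antidiagonal 3).over L))) ∧ Kf ≤ ((((standardMaximalCompactGL 3 L).comap (adelicVal (↥(maximalRealSubfield L)) L (IsCMField.complexConj L) 3 ((StdForm.antidiagonal 3).over L)) : Subgroup (quasiSplit (↥(maximalRealSubfield L)) L (IsCMField.complexConj L) 3).Adelic)).comap (finAdelicToAdelic (↥(maximalRealSubfield L)) L (IsCMField.complexConj L) 3 ((StdForm.antidiagonal 3).over L)) : Subgroup ↥(finAdelic (↥(maximalRealSubfield L)) L (IsCMField.complexConj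 L) 3 ((StdForm.antidiagonal 3).over L)))}) (b : β), ∀ t ∈ {v : (quasiSplit (↥(maximalRealSubfield L)) L (IsCMField.complexConj L) 3).L2 μ |
          ∃ (f : ℝ → ℂ) (_ : Continuous f) (_ : HasCompactSupport f) (_ : tsupport f ⊆ Ioi 0)
            (φ : (quasiSplit (↥(maximalRealSubfield L)) L (IsCMField.complexConj L) 3).Adelic → ℂ) (_ : φ ∈ chiSectionSpacePair (reflectChar (IsCMField.complexConj L) (χ₁ b)) (χ₂ b) (Kf.1.map (finAdelicToAdelic (↥(maximalRealSubfield L)) L (IsCMField.complexConj L) 3 ((StdForm.antidiagonal 3).over L))) ((1 : ↥(Kf.1.map (finAdelicToAdelic (↥(maximalRealSubfield L)) L (IsCMField.complexConj L) 3 ((StdForm.antidiagonal 3).over L))) →* ℂ) : ↥(Kf.1.map (finAdelicToAdelic (↥(maximalRealSubfield L)) L (IsCMField.complexConj L) 3 ((StdForm.antidiagonal 3).over L))) → ℂ)) (_ : Continuous φ)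
            (hv : MemLp ((quasiSplit (↥(maximalRealSubfield L)) L (IsCMField.complexConj L) 3).quotFun (eisensteinSeriesU (fun g => f (borelHeight g) * φ g))) 2 μ), v = hv.toLp _},
      U Kf b t ∈ closure (((Submodule.span ℂ
        {v : (quasiSplit (↥(maximalRealSubfield L)) L (IsCMField.complexConj L) 3).L2 μ |
          ∃ (f : ℝ → ℂ) (_ : Continuous f) (_ : HasCompactSupport f) (_ : tsupport f ⊆ Ioi 0)
            (φ : (quasiSplit (↥(maximalRealSubfield L)) L (IsCMField.complexConj L) 3).Adelic → ℂ) (_ : φ ∈ chiSectionSpacePair (χ₁ b) (χ₂ b) (Kf.1.map (finAdelicToAdelic (↥(maximalRealSubfield L)) L (IsCMField.complexConj L) 3 ((StdForm.antidiagonal 3).over L))) ((1 : ↥(Kf.1.map (finAdelicToAdelic (↥(maximalRealSubfield L)) L (IsCMField.complexConj L) 3 ((StdForm.antidiagonal 3).over L))) →* ℂ) : ↥(Kf.1.map (finAdelicToAdelic (↥(maximalRealSubfield L)) L (IsCMField.complexConj L) 3 ((StdForm.antidiagonal 3).over L))) → ℂ)) (_ : Continuous φ)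
            (hv : MemLp ((quasiSplit (↥(maximalRealSubfield L)) L (IsCMField.complexConj L) 3).quotFun (eisensteinSeriesU (fun g => f (borelHeight g) * φ g))) 2 μ), v = hv.toLp _}).map (U Kf b) : Submodule ℂ (𝓜 Kf b)) : Set (𝓜 Kf b)))
    (Kf : {Kf : Subgroup ↥(finAdelic (↥(maximalRealSubfield L)) L (IsCMField.complexConj L) 3 ((StdForm.antidiagonal 3).over L)) // IsOpen ((Kf : Subgroup ↥(finAdelic (↥(maximalRealSubfield L)) L (IsCMField.complexConj L) 3 ((StdForm.antidiagonal 3).over L))) : Set ↥(finAdelic (↥(maximalRealSubfield L)) L (IsCMField.complexConj L) 3 ((StdForm.antidiagonal 3).over L))) ∧ Kf ≤ ((((standardMaximalCompactGL 3 L).comap (adelicVal (↥(maximalRealSubfield L)) L (IsCMField.complexConj L) 3 ((StdForm.antidiagonal 3).over L)) : Subgroup (quasiSplit (↥(maximalRealSubfield L)) L (IsCMField.complexConj L) 3).Adelic)).comap (finAdelicToAdelic (↥(maximalRealSubfield L)) L (IsCMField.complexConj L) 3 ((StdForm.antidiagonal 3).over L)) : Subgroup ↥(finAdelic (↥(maximalRealSubfield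 L)) L (IsCMField.complexConj L) 3 ((StdForm.antidiagonal 3).over L)))}) (b : β) :
    resGBlock L μ (Kf.1.map (finAdelicToAdelic (↥(maximalRealSubfield L)) L (IsCMField.complexConj L) 3 ((StdForm.antidiagonal 3).over L))) 1 (reflectChar (IsCMField.complexConj L) (χ₁ b)) (χ₂ b) ≤ resGBlock L μ (Kf.1.map (finAdelicToAdelic (↥(maximalRealSubfield L)) L (IsCMField.complexConj L) 3 ((StdForm.antidiagonal 3).over L))) 1 (χ₁ b) (χ₂ b) :=
  resGBlock_reflectChar_le_of_axisModel L μ _ 1 (χ₁ b) (χ₂ b) (U Kf b) (hU Kf b) (hFE Kf b)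

/-- **(HEAD₃) `hHead_level` FROM {GEN₃^X, WITNESS_β, per-block AXIS MODELS}** (★ `hHead_level_of_niceCoreAll_of_transversal` with `hassoc := hassoc_of_axisModels …`): after this file the
(E) column reads (HEAD₃) = ★ modulo {GEN₃^X (L), (ISO)+(FE) per block (L, E1 Plancherel estate)} + the payer's bookkeeping `hmem` and the Borel guards. [cite: MoeglinWaldspurger1995, II.2.1, II.2.4] -/
theorem hHead_level_of_niceCoreAll_of_axisModels
    (𝔓 : (quasiSplit (↥(maximalRealSubfield L)) L (IsCMField.complexConj L) 3).ParabolicUnipotentData) (hne : Nonempty 𝔓.ι) (h𝔓 : ∀ i : 𝔓.ι, 𝔓.radical i = adelicUnipotent (↥(maximalRealSubfield L)) L (IsCMField.complexConj L) 3)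
    [MeasurableSpace (quasiSplit (↥(maximalRealSubfield L)) L (IsCMField.complexConj L) 3).Adelic] [BorelSpace (quasiSplit (↥(maximalRealSubfield L)) L (IsCMField.complexConj L) 3).Adelic] [(quasiSplit (↥(maximalRealSubfield L)) L (IsCMField.complexConj L) 3).IsAutomorphicMeasure μ]
    {β : Type*} (χ₁ : β → HeckeCharacter L) (χ₂ : β → (↥(TorusDict.torus (IsCMField.complexConj L)) →ₜ* ℂˣ))
    {X : {Kf : Subgroup ↥(finAdelic (↥(maximalRealSubfield L)) L (IsCMField.complexConj L) 3 ((StdForm.antidiagonal 3).over L)) // IsOpen ((Kf : Subgroup ↥(finAdelic (↥(maximalRealSubfield L)) L (IsCMField.complexConj L) 3 ((StdForm.antidiagonal 3).over L))) : Set ↥(finAdelic (↥(maximalRealSubfield L)) L (IsCMField.complexConj L) 3 ((StdForm.antidiagonal 3).over L))) ∧ Kf ≤ ((((standardMaximalCompactGL 3 L).comap (adelicVal (↥(maximalRealSubfield L)) L (IsCMField.complexConj L) 3 ((StdForm.antidiagonal 3).over L)) : Subgroup (quasiSplit (↥(maximalRealSubfield L)) L (IsCMField.complexConj L) 3).Adelic)).comap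 (finAdelicToAdelic (↥(maximalRealSubfield L)) L (IsCMField.complexConj L) 3 ((StdForm.antidiagonal 3).over L)) : Subgroup ↥(finAdelic (↥(maximalRealSubfield L)) L (IsCMField.complexConj L) 3 ((StdForm.antidiagonal 3).over L)))} → Type*}
    (η₁ : ∀ Kf, X Kf → HeckeCharacter L) (η₂ : ∀ Kf, X Kf → (↥(TorusDict.torus (IsCMField.complexConj L)) →ₜ* ℂˣ))
    (hall : ∀ Kf : {Kf : Subgroup ↥(finAdelic (↥(maximalRealSubfield L)) L (IsCMField.complexConj L) 3 ((StdForm.antidiagonal 3).over L)) // IsOpen ((Kf : Subgroup ↥(finAdelic (↥(maximalRealSubfield L)) L (IsCMField.complexConj L) 3 ((StdForm.antidiagonal 3).over L))) : Set ↥(finAdelic (↥(maximalRealSubfield L)) L (IsCMField.complexConj L) 3 ((StdForm.antidiagonal 3).over L))) ∧ Kf ≤ ((((standardMaximalCompactGL 3 L).comap (adelicVal (↥(maximalRealSubfield L)) L (IsCMField.complexConj L) 3 ((StdForm.antidiagonal 3).over L)) : Subgroup (quasiSplit (↥(maximalRealSubfield L)) L (IsCMField.complexConj L) 3).Adelic)).comap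 (finAdelicToAdelic (↥(maximalRealSubfield L)) L (IsCMField.complexConj L) 3 ((StdForm.antidiagonal 3).over L)) : Subgroup ↥(finAdelic (↥(maximalRealSubfield L)) L (IsCMField.complexConj L) 3 ((StdForm.antidiagonal 3).over L)))},
      {f : (quasiSplit (↥(maximalRealSubfield L)) L (IsCMField.complexConj L) 3).L2 μ | ∃ (i : 𝔓.ι) (Φ : (quasiSplit (↥(maximalRealSubfield L)) L (IsCMField.complexConj L) 3).Adelic → ℂ) (_ : Measurable Φ)
        (_ : ∀ (g : (quasiSplit (↥(maximalRealSubfield L)) L (IsCMField.complexConj L) 3).Adelic) (n : 𝔓.radical i), Φ (g * n) = Φ g)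
        (_ : ∫⁻ x, (∑' q : (quasiSplit (↥(maximalRealSubfield L)) L (IsCMField.complexConj L) 3).quotientSubgroup ⧸ (𝔓.radical i).subgroupOf (quasiSplit (↥(maximalRealSubfield L)) L (IsCMField.complexConj L) 3).quotientSubgroup,
          ‖Φ ((Quotient.out x : (quasiSplit (↥(maximalRealSubfield L)) L (IsCMField.complexConj L) 3).Adelic) * ((q.out : (quasiSplit (↥(maximalRealSubfield L)) L (IsCMField.complexConj L) 3).quotientSubgroup) : (quasiSplit (↥(maximalRealSubfield L)) L (IsCMField.complexConj L) 3).Adelic))‖ₑ) ^ 2 ∂μ < ∞)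
        (_ : Continuous Φ) (_ : ∃ M : ℝ, ∀ g, ‖Φ g‖ ≤ M) (_ : ∃ C : Set (quasiSplit (↥(maximalRealSubfield L)) L (IsCMField.complexConj L) 3).Adelic, IsCompact C ∧ ∀ g, g ∉ C * ((𝔓.radical i : Subgroup (quasiSplit (↥(maximalRealSubfield L)) L (IsCMField.complexConj L) 3).Adelic) : Set (quasiSplit (↥(maximalRealSubfield L)) L (IsCMField.complexConj L) 3).Adelic) → Φ g = 0)
        (_ : ∀ (u : ↥(Kf.1)) (h : (quasiSplit (↥(maximalRealSubfield L)) L (IsCMField.complexConj L) 3).Adelic), Φ (finAdelicToAdelic (↥(maximalRealSubfield L)) L (IsCMField.complexConj L) 3 ((StdForm.antidiagonal 3).over L) (u : ↥(finAdelic (↥(maximalRealSubfield L)) L (IsCMField.complexConj L) 3 ((StdForm.antidiagonal 3).over L))) * h) = Φ h)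
        (hθ : MemLp (fun x : (quasiSplit (↥(maximalRealSubfield L)) L (IsCMField.complexConj L) 3).automorphicQuotient => ∑' q : (quasiSplit (↥(maximalRealSubfield L)) L (IsCMField.complexConj L) 3).quotientSubgroup ⧸ (𝔓.radical i).subgroupOf (quasiSplit (↥(maximalRealSubfield L)) L (IsCMField.complexConj L) 3).quotientSubgroup,
          Φ ((Quotient.out x : (quasiSplit (↥(maximalRealSubfield L)) L (IsCMField.complexConj L) 3).Adelic) * ((q.out : (quasiSplit (↥(maximalRealSubfield L)) L (IsCMField.complexConj L) 3).quotientSubgroup) : (quasiSplit (↥(maximalRealSubfield L)) L (IsCMField.complexConj L) 3).Adelic))) 2 μ), f = hθ.toLp _} ⊆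
        ((⨆ x : X Kf, resGBlock L μ (Kf.1.map (finAdelicToAdelic (↥(maximalRealSubfield L)) L (IsCMField.complexConj L) 3 ((StdForm.antidiagonal 3).over L))) 1 (η₁ Kf x) (η₂ Kf x)).topologicalClosure : Set ((quasiSplit (↥(maximalRealSubfield L)) L (IsCMField.complexConj L) 3).L2 μ)))
    (hmem : ∀ (Kf : {Kf : Subgroup ↥(finAdelic (↥(maximalRealSubfield L)) L (IsCMField.complexConj L) 3 ((StdForm.antidiagonal 3).over L)) // IsOpen ((Kf : Subgroup ↥(finAdelic (↥(maximalRealSubfield L)) L (IsCMField.complexConj L) 3 ((StdForm.antidiagonal 3).over L))) : Set ↥(finAdelic (↥(maximalRealSubfield L)) L (IsCMField.complexConj L) 3 ((StdForm.antidiagonal 3).over L))) ∧ Kf ≤ ((((standardMaximalCompactGL 3 L).comap (adelicVal (↥(maximalRealSubfield L)) L (IsCMField.complexConj L) 3 ((StdForm.antidiagonal 3).over L)) : Subgroup (quasiSplit (↥(maximalRealSubfield L)) L (IsCMField.complexConj L) 3).Adelic)).comap (finAdelicToAdelic (↥(maximalRealSubfield L)) L (IsCMField.complexConj L) 3 ((StdForm.antidiagonal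 3).over L)) : Subgroup ↥(finAdelic (↥(maximalRealSubfield L)) L (IsCMField.complexConj L) 3 ((StdForm.antidiagonal 3).over L)))}) (x : X Kf),
      ∃ b : β, (η₁ Kf x = χ₁ b ∧ η₂ Kf x = χ₂ b) ∨ (η₁ Kf x = reflectChar (IsCMField.complexConj L) (χ₁ b) ∧ η₂ Kf x = χ₂ b))
    {𝓜 : {Kf : Subgroup ↥(finAdelic (↥(maximalRealSubfield L)) L (IsCMField.complexConj L) 3 ((StdForm.antidiagonal 3).over L)) // IsOpen ((Kf : Subgroup ↥(finAdelic (↥(maximalRealSubfield L)) L (IsCMField.complexConj L) 3 ((StdForm.antidiagonal 3).over L))) : Set ↥(finAdelic (↥(maximalRealSubfield L)) L (IsCMField.complexConj L) 3 ((StdForm.antidiagonal 3).over L))) ∧ Kf ≤ ((((standardMaximalCompactGL 3 L).comap (adelicVal (↥(maximalRealSubfield L)) L (IsCMField.complexConj L) 3 ((StdForm.antidiagonal 3).over L)) : Subgroup (quasiSplit (↥(maximalRealSubfield L)) L (IsCMField.complexConj L) 3).Adelic)).comap (finAdelicToAdelic (↥(maximalRealSubfield L)) L (IsCMField.complexConj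 L) 3 ((StdForm.antidiagonal 3).over L)) : Subgroup ↥(finAdelic (↥(maximalRealSubfield L)) L (IsCMField.complexConj L) 3 ((StdForm.antidiagonal 3).over L)))} → β → Type*}
    [∀ Kf b, NormedAddCommGroup (𝓜 Kf b)] [∀ Kf b, NormedSpace ℂ (𝓜 Kf b)]
    (U : ∀ (Kf : {Kf : Subgroup ↥(finAdelic (↥(maximalRealSubfield L)) L (IsCMField.complexConj L) 3 ((StdForm.antidiagonal 3).over L)) // IsOpen ((Kf : Subgroup ↥(finAdelic (↥(maximalRealSubfield L)) L (IsCMField.complexConj L) 3 ((StdForm.antidiagonal 3).over L))) : Set ↥(finAdelic (↥(maximalRealSubfield L)) L (IsCMField.complexConj L) 3 ((StdForm.antidiagonal 3).over L))) ∧ Kf ≤ ((((standardMaximalCompactGL 3 L).comap (adelicVal (↥(maximalRealSubfield L)) L (IsCMField.complexConj L) 3 ((StdForm.antidiagonal 3).over L)) : Subgroup (quasiSplit (↥(maximalRealSubfield L)) L (IsCMField.complexConj L) 3).Adelic)).comap (finAdelicToAdelic (↥(maximalRealSubfield L)) L (IsCMField.complexConj L) 3 ((StdForm.antidiagonal 3).over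 L)) : Subgroup ↥(finAdelic (↥(maximalRealSubfield L)) L (IsCMField.complexConj L) 3 ((StdForm.antidiagonal 3).over L)))}) (b : β), (quasiSplit (↥(maximalRealSubfield L)) L (IsCMField.complexConj L) 3).L2 μ →ₗ[ℂ] 𝓜 Kf b)
    (hU : ∀ (Kf : {Kf : Subgroup ↥(finAdelic (↥(maximalRealSubfield L)) L (IsCMField.complexConj L) 3 ((StdForm.antidiagonal 3).over L)) // IsOpen ((Kf : Subgroup ↥(finAdelic (↥(maximalRealSubfield L)) L (IsCMField.complexConj L) 3 ((StdForm.antidiagonal 3).over L))) : Set ↥(finAdelic (↥(maximalRealSubfield L)) L (IsCMField.complexConj L) 3 ((StdForm.antidiagonal 3).over L))) ∧ Kf ≤ ((((standardMaximalCompactGL 3 L).comap (adelicVal (↥(maximalRealSubfield L)) L (IsCMField.complexConj L) 3 ((StdForm.antidiagonal 3).over L)) : Subgroup (quasiSplit (↥(maximalRealSubfield L)) L (IsCMField.complexConj L) 3).Adelic)).comap (finAdelicToAdelic (↥(maximalRealSubfield L)) L (IsCMField.complexConj L) 3 ((StdForm.antidiagonal 3).over L)) : Subgroup ↥(finAdelic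 (↥(maximalRealSubfield L)) L (IsCMField.complexConj L) 3 ((StdForm.antidiagonal 3).over L)))}) (b : β), ∀ a ∈ Submodule.span ℂ
      ({v : (quasiSplit (↥(maximalRealSubfield L)) L (IsCMField.complexConj L) 3).L2 μ |
          ∃ (f : ℝ → ℂ) (_ : Continuous f) (_ : HasCompactSupport f) (_ : tsupport f ⊆ Ioi 0)
            (φ : (quasiSplit (↥(maximalRealSubfield L)) L (IsCMField.complexConj L) 3).Adelic → ℂ) (_ : φ ∈ chiSectionSpacePair (χ₁ b) (χ₂ b) (Kf.1.map (finAdelicToAdelic (↥(maximalRealSubfield L)) L (IsCMField.complexConj L) 3 ((StdForm.antidiagonal 3).over L))) ((1 : ↥(Kf.1.map (finAdelicToAdelic (↥(maximalRealSubfield L)) L (IsCMField.complexConj L) 3 ((StdForm.antidiagonal 3).over L))) →* ℂ) : ↥(Kf.1.map (finAdelicToAdelic (↥(maximalRealSubfield L)) L (IsCMField.complexConj L) 3 ((StdForm.antidiagonal 3).over L))) → ℂ)) (_ : Continuous φ)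
            (hv : MemLp ((quasiSplit (↥(maximalRealSubfield L)) L (IsCMField.complexConj L) 3).quotFun (eisensteinSeriesU (fun g => f (borelHeight g) * φ g))) 2 μ), v = hv.toLp _} ∪
       {v : (quasiSplit (↥(maximalRealSubfield L)) L (IsCMField.complexConj L) 3).L2 μ |
          ∃ (f : ℝ → ℂ) (_ : Continuous f) (_ : HasCompactSupport f) (_ : tsupport f ⊆ Ioi 0)
            (φ : (quasiSplit (↥(maximalRealSubfield L)) L (IsCMField.complexConj L) 3).Adelic → ℂ) (_ : φ ∈ chiSectionSpacePair (reflectChar (IsCMField.complexConj L) (χ₁ b)) (χ₂ b) (Kf.1.map (finAdelicToAdelic (↥(maximalRealSubfield L)) L (IsCMField.complexConj L) 3 ((StdForm.antidiagonal 3).over L))) ((1 : ↥(Kf.1.map (finAdelicToAdelic (↥(maximalRealSubfield L)) L (IsCMField.complexConj L) 3 ((StdForm.antidiagonal 3).over L))) →* ℂ) : ↥(Kf.1.map (finAdelicToAdelic (↥(maximalRealSubfield L)) L (IsCMField.complexConj L) 3 ((StdForm.antidiagonal 3).over L))) → ℂ)) (_ : Continuous φ)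
            (hv : MemLp ((quasiSplit (↥(maximalRealSubfield L)) L (IsCMField.complexConj L) 3).quotFun (eisensteinSeriesU (fun g => f (borelHeight g) * φ g))) 2 μ), v = hv.toLp _}), ‖U Kf b a‖ = ‖a‖)
    (hFE : ∀ (Kf : {Kf : Subgroup ↥(finAdelic (↥(maximalRealSubfield L)) L (IsCMField.complexConj L) 3 ((StdForm.antidiagonal 3).over L)) // IsOpen ((Kf : Subgroup ↥(finAdelic (↥(maximalRealSubfield L)) L (IsCMField.complexConj L) 3 ((StdForm.antidiagonal 3).over L))) : Set ↥(finAdelic (↥(maximalRealSubfield L)) L (IsCMField.complexConj L) 3 ((StdForm.antidiagonal 3).over L))) ∧ Kf ≤ ((((standardMaximalCompactGL 3 L).comap (adelicVal (↥(maximalRealSubfield L)) L (IsCMField.complexConj L) 3 ((StdForm.antidiagonal 3).over L)) : Subgroup (quasiSplit (↥(maximalRealSubfield L)) L (IsCMField.complexConj L) 3).Adelic)).comap (finAdelicToAdelic (↥(maximalRealSubfield L)) L (IsCMField.complexConj L) 3 ((StdForm.antidiagonal 3).over L)) : Subgroup ↥(finAdelic (↥(maximalRealSubfield L)) L (IsCMField.complexConj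 L) 3 ((StdForm.antidiagonal 3).over L)))}) (b : β), ∀ t ∈ {v : (quasiSplit (↥(maximalRealSubfield L)) L (IsCMField.complexConj L) 3).L2 μ |
          ∃ (f : ℝ → ℂ) (_ : Continuous f) (_ : HasCompactSupport f) (_ : tsupport f ⊆ Ioi 0)
            (φ : (quasiSplit (↥(maximalRealSubfield L)) L (IsCMField.complexConj L) 3).Adelic → ℂ) (_ : φ ∈ chiSectionSpacePair (reflectChar (IsCMField.complexConj L) (χ₁ b)) (χ₂ b) (Kf.1.map (finAdelicToAdelic (↥(maximalRealSubfield L)) L (IsCMField.complexConj L) 3 ((StdForm.antidiagonal 3).over L))) ((1 : ↥(Kf.1.map (finAdelicToAdelic (↥(maximalRealSubfield L)) L (IsCMField.complexConj L) 3 ((StdForm.antidiagonal 3).over L))) →* ℂ) : ↥(Kf.1.map (finAdelicToAdelic (↥(maximalRealSubfield L)) L (IsCMField.complexConj L) 3 ((StdForm.antidiagonal 3).over L))) → ℂ)) (_ : Continuous φ)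
            (hv : MemLp ((quasiSplit (↥(maximalRealSubfield L)) L (IsCMField.complexConj L) 3).quotFun (eisensteinSeriesU (fun g => f (borelHeight g) * φ g))) 2 μ), v = hv.toLp _},
      U Kf b t ∈ closure (((Submodule.span ℂ
        {v : (quasiSplit (↥(maximalRealSubfield L)) L (IsCMField.complexConj L) 3).L2 μ |
          ∃ (f : ℝ → ℂ) (_ : Continuous f) (_ : HasCompactSupport f) (_ : tsupport f ⊆ Ioi 0)
            (φ : (quasiSplit (↥(maximalRealSubfield L)) L (IsCMField.complexConj L) 3).Adelic → ℂ) (_ : φ ∈ chiSectionSpacePair (χ₁ b) (χ₂ b) (Kf.1.map (finAdelicToAdelic (↥(maximalRealSubfield L)) L (IsCMField.complexConj L) 3 ((StdForm.antidiagonal 3).over L))) ((1 : ↥(Kf.1.map (finAdelicToAdelic (↥(maximalRealSubfield L)) L (IsCMField.complexConj L) 3 ((StdForm.antidiagonal 3).over L))) →* ℂ) : ↥(Kf.1.map (finAdelicToAdelic (↥(maximalRealSubfield L)) L (IsCMField.complexConj L) 3 ((StdForm.antidiagonal 3).over L))) → ℂ)) (_ : Continuous φ)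
            (hv : MemLp ((quasiSplit (↥(maximalRealSubfield L)) L (IsCMField.complexConj L) 3).quotFun (eisensteinSeriesU (fun g => f (borelHeight g) * φ g))) 2 μ), v = hv.toLp _}).map (U Kf b) : Submodule ℂ (𝓜 Kf b)) : Set (𝓜 Kf b)))
    (Kf : {Kf : Subgroup ↥(finAdelic (↥(maximalRealSubfield L)) L (IsCMField.complexConj L) 3 ((StdForm.antidiagonal 3).over L)) // IsOpen ((Kf : Subgroup ↥(finAdelic (↥(maximalRealSubfield L)) L (IsCMField.complexConj L) 3 ((StdForm.antidiagonal 3).over L))) : Set ↥(finAdelic (↥(maximalRealSubfield L)) L (IsCMField.complexConj L) 3 ((StdForm.antidiagonal 3).over L))) ∧ Kf ≤ ((((standardMaximalCompactGL 3 L).comap (adelicVal (↥(maximalRealSubfield L)) L (IsCMField.complexConj L) 3 ((StdForm.antidiagonal 3).over L)) : Subgroup (quasiSplit (↥(maximalRealSubfield L)) L (IsCMField.complexConj L) 3).Adelic)).comap (finAdelicToAdelic (↥(maximalRealSubfield L)) L (IsCMField.complexConj L) 3 ((StdForm.antidiagonal 3).over L)) : Subgroup ↥(finAdelic (↥(maximalRealSubfield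 L)) L (IsCMField.complexConj L) 3 ((StdForm.antidiagonal 3).over L)))}) :
    ((quasiSplit (↥(maximalRealSubfield L)) L (IsCMField.complexConj L) 3).cuspidalSubspace μ 𝔓).toSubmoduleᗮ ⊓ (⨅ u : ↥(Kf.1), Module.End.eigenspace ((((quasiSplit (↥(maximalRealSubfield L)) L (IsCMField.complexConj L) 3).rightRegular μ) (finAdelicToAdelic (↥(maximalRealSubfield L)) L (IsCMField.complexConj L) 3 ((StdForm.antidiagonal 3).over L) (u : ↥(finAdelic (↥(maximalRealSubfield L)) L (IsCMField.complexConj L) 3 ((StdForm.antidiagonal 3).over L)))) :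
        (quasiSplit (↥(maximalRealSubfield L)) L (IsCMField.complexConj L) 3).L2 μ →L[ℂ] (quasiSplit (↥(maximalRealSubfield L)) L (IsCMField.complexConj L) 3).L2 μ) : (quasiSplit (↥(maximalRealSubfield L)) L (IsCMField.complexConj L) 3).L2 μ →ₗ[ℂ] (quasiSplit (↥(maximalRealSubfield L)) L (IsCMField.complexConj L) 3).L2 μ) 1) ≤ (⨆ b, resGBlock L μ (Kf.1.map (finAdelicToAdelic (↥(maximalRealSubfield L)) L (IsCMField.complexConj L) 3 ((StdForm.antidiagonal 3).over L))) 1 (χ₁ b) (χ₂ b)).topologicalClosure :=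
  hHead_level_of_niceCoreAll_of_transversal L μ 𝔓 hne h𝔓 χ₁ χ₂ η₁ η₂ hall hmem (hassoc_of_axisModels L μ χ₁ χ₂ U hU hFE) Kf

end Assembly

end Summit.HodgeConjecture.HodgeConjecture.R90.S8

end
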